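import Summits.Ventures.CertifiedArithmetic.LowPrec.DoubleRoundingSqrtCapture

/-!
# Double rounding of square roots below the underflow clause: THEOREM D-sqrt-T (the threshold)

HONEST FRAMING: certified error envelopes and provably optimal rounding/accumulation schemes for
low-precision formats under stated cost models; every table by two implementations; no hardware or
vendor claims. "Square root in format `ψ`" is the correctly rounded square root of the record `ψ`
as a mathematical function (`roundNESqrt`, `RoundSqrt.lean`).

THE QUESTION. For records `F_φ ⊆ F_ψ` with `P_ψ ≥ 2P_φ + 2`, `m_φ ≥ 1` and
`quantum_φ = 2^d quantum_ψ`, `d ≥ 1`, THEOREM D-sqrt-U′ (`drSqrt_of_deep`; = [Roux2014, Table II]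
disjunct 1 read on records) gives `DRSqrt φ ψ` for `d ≥ m + 3`, and LAW N-sqrt-U′
(`not_drSqrt_of_shallow`) refutes it for `d ≤ m + 2 - g₀`, `g₀ := ⌈(bias_φ - 2)/2⌉₊ =
(bias_φ - 1)/2` (natural division), by the failure family at the lowest binade `g₀` whose operand
is on the grid (range permitting). For sources of bias `≥ 3` the depths
`m + 3 - g₀ ≤ d ≤ m + 2` were undecided (DOUBLE-ROUNDING-SQRT.md §5b: e.g. e3m2, bias 3, `d = 4`,
innocuous by exhaustion).

THEOREM D-sqrt-T (`drSqrt_iff_threshold`, this packet). Under the hypotheses above, the range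
hypothesis of the family at binade `g₀` (upper neighbour `2^(m+1+g₀)` and operand
`(2^(m+1) - 1) 2^(2g₀+2-bias)` quanta finite) and the CAPTURE TABLE `sqrtCapFree m_φ` (a finite
statement about integers, by `decide +kernel` for `m ≤ 5` in `DoubleRoundingSqrtThresholdTable
.lean`; implementation A `code/enum/sqrt_threshold_law.py`):
`DRSqrt φ ψ ↔ d ≥ m + 3 - g₀`. The sufficiency half (`drSqrt_of_capFree`) needs no range
hypothesis; for `bias_φ ≥ 2m + 5` it says that EVERY deeper register with `P_ψ ≥ 2P_φ + 2` is
innocuous, and for `bias_φ ≥ 3m + 6` this holds without the table (`drSqrt_of_bias_ge`, sizes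
only).

PROOF. A slip has the capture data of `sqrt_slip_capture` (`DoubleRoundingSqrtCapture.lean`): in
units of `ν = quantum_ψ/2`, a midpoint `M = (2V+1) 2^G` (`d ≤ G ≤ m+2`, `V < 2^(m+1)`) and an
operand `Z = A 2^κ` (`1 ≤ A < 2^(m+1)`, `2d + 1 + bias + m ≤ κ ≤ 2m + 4 + 2G`) with
`(M-1)² ≤ Z ≤ (M+1)²`, `Z ≠ M²`. THE TABLE SAYS `κ ≤ 3m + 7` for every capture (attained only by
the family: `V = A = 2^(m+1) - 1`, `G = m + 2`; and at `m = 6` also by `181² + 7 = 2^15`,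
`G = 5` — a Ramanujan–Nagell coincidence, which is why no size argument replaces the table).
Reading `κ = α + 2d + 1 + bias + m` (`α ≥ 0` the dyadic valuation of the operand's significand):
`2d + bias ≤ 2m + 6`, i.e. `d ≤ m + 3 - ⌈bias/2⌉ = m + 2 - g₀` (and `d ≤ G ≤ m + 2`): no slip at
any depth `d ≥ m + 3 - g₀`. Conversely LAW N-sqrt-U′ at `g = g₀`.

FILE MAP. §2 the capture test `sqrtCapAt`, the table statement `sqrtCapFree m` and its
instantiation; §3 `drSqrt_of_noCapture` (the surrogate reduction), `drSqrt_of_capFree`,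
`drSqrt_of_bias_ge`, `drSqrt_iff_threshold`, the parameter test `drSqrtThreshTest` with
soundness. Tables and readings: `DoubleRoundingSqrtThresholdTable.lean`. No `sorry`.

KNOWN / REPRODUCED / NEW. KNOWN: `p₂ ≥ 2p₁ + 2` with unbounded exponents [Figueroa1995, §3],
with gradual underflow under `emin₂ ≤ emin₁ - p₁ - 2 ∨ 2emin₂ ≤ emin₁ - 4p₁ - 2` [Roux2014,
Thm 25, Table II] (Coq/Flocq; sufficient conditions, optimality discussed for the precision
only). NEW as far as searched (pub-lowprec-enum/FRESHNESS-ENUM.md gen35, corpus + galaxy): the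
EXACT exponent threshold `d ≥ m + 3 - ⌈(bias-2)/2⌉₊` for finite saturating records of every
bias (kernel-certified for `m ≤ 5`, implementation A to `m = 8`), the reduction of the window to
the integer capture table, and its tight cases.
-/

namespace Summit.Ventures.CertifiedArithmetic

open Literature.ComputerArithmetic.FloatingPoint
open Literature.ComputerArithmetic.FloatingPoint.Format
open Literature.ComputerArithmetic.FloatingPoint.MiniFloat

/-! ## §2 The capture table -/

/-- THE CAPTURE TEST in units of `ν = quantum_ψ/2`: the midpoint `M = (2V+1) 2^G` catches the
root of `Z = A 2^κ` at spacing `2ν`, i.e. `(M-1)² ≤ Z ≤ (M+1)²` and `Z ≠ M²`. [this packet] -/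
def sqrtCapAt (G V A κ : ℕ) : Bool :=
  decide (((2 * (V : ℤ) + 1) * 2 ^ G - 1) ^ 2 ≤ (A : ℤ) * 2 ^ κ) &&
    decide ((A : ℤ) * 2 ^ κ ≤ ((2 * (V : ℤ) + 1) * 2 ^ G + 1) ^ 2) &&
    !decide ((A : ℤ) * 2 ^ κ = ((2 * (V : ℤ) + 1) * 2 ^ G) ^ 2)

/-- THE CAPTURE TABLE `T(m)`: no capture with `1 ≤ G ≤ m + 2`, `V < 2^(m+1)`, `1 ≤ A < 2^(m+1)`
and `3m + 8 ≤ κ ≤ 2m + 4 + 2G` (written with `G = G' + 1`, `κ = 3m + 8 + j`; the `κ`-range is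
empty unless `2G ≥ m + 5`). Equivalently: every capture has `κ ≤ 3m + 7`. One boolean for the
kernel (`DoubleRoundingSqrtThresholdTable.lean`: `true` for `1 ≤ m ≤ 5`; implementation A
`code/enum/sqrt_threshold_law.py`: `true` for `m ≤ 8`). [this packet] -/
def sqrtCapFree (m : ℕ) : Bool :=
  (List.range (m + 2)).all fun G' =>
    (List.range (2 * G' - m - 1)).all fun j =>
      (List.range (2 ^ (m + 1))).all fun V =>
        (List.range (2 ^ (m + 1))).all fun A =>
          A == 0 || !sqrtCapAt (G' + 1) V A (3 * m + 8 + j)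

/-- Instantiating the table: inside its box there is no capture. [this packet] -/
theorem sqrtCapAt_eq_false {m G V A κ : ℕ} (h : sqrtCapFree m = true) (hG1 : 1 ≤ G)
    (hG : G ≤ m + 2) (hV : V < 2 ^ (m + 1)) (hA1 : 1 ≤ A) (hA : A < 2 ^ (m + 1))
    (hκlo : 3 * m + 8 ≤ κ) (hκhi : κ ≤ 2 * m + 4 + 2 * G) : sqrtCapAt G V A κ = false := by
  obtain ⟨G', rfl⟩ := Nat.exists_eq_add_of_le' hG1
  obtain ⟨j, rfl⟩ := Nat.exists_eq_add_of_le hκlo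
  have h2 := List.all_eq_true.mp h G' (List.mem_range.mpr (by omega))
  have h3 := List.all_eq_true.mp h2 j (List.mem_range.mpr (by omega))
  have h4 := List.all_eq_true.mp h3 V (List.mem_range.mpr hV)
  have h5 := List.all_eq_true.mp h4 A (List.mem_range.mpr hA)
  rw [Bool.or_eq_true] at h5
  rcases h5 with h5 | h5
  · rw [beq_iff_eq] at h5; omega
  · simpa using h5

/-! ## §3 The threshold -/

/-- FROM NO CAPTURE TO `DRSqrt` (the surrogate reduction of `drSqrt_of_low` on
`sqrt_slip_capture`): records `F_φ ⊆ F_ψ`, `P_ψ ≥ 2P_φ + 2`, `m_φ ≥ 1`, `L_ψ < L_φ`; if no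
capture data as in `sqrt_slip_capture` exist, then `DRSqrt φ ψ`. [this packet] -/
theorem drSqrt_of_noCapture {φ ψ : Format} (hE : embedsTest φ ψ = true)
    (hm : 2 * φ.manBits + 3 ≤ ψ.manBits) (h1 : 1 ≤ φ.manBits) (hq1 : ψ.qexp + 1 ≤ φ.qexp)
    (H : ∀ G V A κ : ℕ, (φ.qexp - ψ.qexp).toNat ≤ G → G ≤ φ.manBits + 2 →
      V < 2 ^ (φ.manBits + 1) → 1 ≤ A → A < 2 ^ (φ.manBits + 1) →
      2 * (φ.qexp - ψ.qexp).toNat + 1 + φ.bias + φ.manBits ≤ κ →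
      κ ≤ 2 * φ.manBits + 4 + 2 * G →
      ((2 * (V : ℤ) + 1) * 2 ^ G - 1) ^ 2 ≤ (A : ℤ) * 2 ^ κ →
      (A : ℤ) * 2 ^ κ ≤ ((2 * (V : ℤ) + 1) * 2 ^ G + 1) ^ 2 →
      (A : ℤ) * 2 ^ κ ≠ ((2 * (V : ℤ) + 1) * 2 ^ G) ^ 2 → False) :
    DRSqrt φ ψ := fun a ha => by
  rw [← toRat_roundNE_sqrtSurr (show ψ.qexp ≤ φ.qexp by omega) ha]
  show (roundNE φ (roundNE ψ (sqrtSurr ψ a.toRat)).toRat).toRat = _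
  rcases ha.eq_or_lt with h0 | hpos
  · rw [← h0, sqrtSurr_zero, toRat_roundNE_zero]
  · by_contra hne
    have key : ∀ {x : ℚ} {n : ℕ},
        ((x = n * (ψ.quantum / 2) ∧ ((n : ℚ) * (ψ.quantum / 2)) ^ 2 = a.toRat) ∨
          (x = ((n : ℚ) + 1 / 2) * (ψ.quantum / 2) ∧ ((n : ℚ) * (ψ.quantum / 2)) ^ 2 < a.toRat ∧
            a.toRat < (((n : ℚ) + 1) * (ψ.quantum / 2)) ^ 2)) →
        (roundNE φ (roundNE ψ x).toRat).toRat ≠ (roundNE φ x).toRat → False := by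
      intro x n hxn h
      obtain ⟨G, V, A, κ, hDG, hG, hV, hA1, hA, hκlo, hκhi, hZlo, hZhi, hZne⟩ :=
        sqrt_slip_capture hE hm h1 hq1 hpos hxn h
      exact H G V A κ hDG hG hV hA1 hA hκlo hκhi hZlo hZhi hZne
    by_cases hex : ((sqrtCell ψ a.toRat : ℚ) * (ψ.quantum / 2)) ^ 2 = a.toRat
    · exact key (Or.inl ⟨sqrtSurr_of_sq_eq hex, hex⟩) hne
    · exact key (Or.inr ⟨sqrtSurr_of_sq_ne hex, (sqrtCell_sq_le ha).lt_of_ne hex,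
        lt_sqrtCell_succ_sq _⟩) hne

/-- THEOREM D-sqrt-T, SUFFICIENCY (no range hypothesis): records `F_φ ⊆ F_ψ`, `P_ψ ≥ 2P_φ + 2`,
`m_φ ≥ 1`, `quantum_φ = 2^d quantum_ψ` with `d ≥ 1`, the capture table `sqrtCapFree m_φ`, and
`d ≥ m_φ + 3 - g₀`, `g₀ = (bias_φ - 1)/2 = ⌈(bias_φ - 2)/2⌉₊`: then `DRSqrt φ ψ`. (A slip would be
a capture with `κ ≥ 2d + 1 + bias + m ≥ 3m + 8`, which the table excludes; for bias `0` the depth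
`d ≥ m + 3` already contradicts `G ≤ m + 2`.) In particular for `bias_φ ≥ 2m_φ + 5` every such `ψ`
is innocuous. [this packet] -/
theorem drSqrt_of_capFree {φ ψ : Format} (hT : sqrtCapFree φ.manBits = true)
    (hE : embedsTest φ ψ = true) (hm : 2 * φ.manBits + 3 ≤ ψ.manBits) (h1 : 1 ≤ φ.manBits)
    (hq1 : ψ.qexp + 1 ≤ φ.qexp)
    (hd : φ.manBits + 3 ≤ (φ.qexp - ψ.qexp).toNat + (φ.bias - 1) / 2) : DRSqrt φ ψ := by
  refine drSqrt_of_noCapture hE hm h1 hq1 fun G V A κ hDG hG hV hA1 hA hκlo hκhi hZlo hZhi hne => ?_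
  have hD : (((φ.qexp - ψ.qexp).toNat : ℕ) : ℤ) = φ.qexp - ψ.qexp := Int.toNat_of_nonneg (by omega)
  have hκ : 3 * φ.manBits + 8 ≤ κ := by omega
  have hc := sqrtCapAt_eq_false hT (by omega) hG hV hA1 hA hκ hκhi
  simp [sqrtCapAt, hZlo, hZhi, hne] at hc

/-- SIZES ONLY (no table): for `bias_φ ≥ 3m_φ + 6` every register with `F_φ ⊆ F_ψ`,
`P_ψ ≥ 2P_φ + 2`, `L_ψ < L_φ` is innocuous (`κ ≥ 2d + 1 + bias + m ≥ 4m + 9 > 2m + 4 + 2G`).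
[this packet] -/
theorem drSqrt_of_bias_ge {φ ψ : Format} (hE : embedsTest φ ψ = true)
    (hm : 2 * φ.manBits + 3 ≤ ψ.manBits) (h1 : 1 ≤ φ.manBits) (hq1 : ψ.qexp + 1 ≤ φ.qexp)
    (hb : 3 * φ.manBits + 6 ≤ φ.bias) : DRSqrt φ ψ := by
  refine drSqrt_of_noCapture hE hm h1 hq1 fun G V A κ hDG hG hV hA1 hA hκlo hκhi _ _ _ => ?_
  have hD : (((φ.qexp - ψ.qexp).toNat : ℕ) : ℤ) = φ.qexp - ψ.qexp := Int.toNat_of_nonneg (by omega)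
  omega

/-- THEOREM D-sqrt-T (THE EXACT DEPTH THRESHOLD). Records `F_φ ⊆ F_ψ`, `P_ψ ≥ 2P_φ + 2`,
`m_φ ≥ 1`, `quantum_φ = 2^d quantum_ψ` with `d ≥ 1`, the capture table `sqrtCapFree m_φ`
(kernel: `m_φ ≤ 5`), and — for the necessity — the failure family of LAW N-sqrt-U′ at the binade
`g₀ = (bias_φ - 1)/2` in range: operand `(2^(m+1) - 1) 2^(2g₀+2-bias)` quanta (the exponent is
`2 - bias` for bias `≤ 2`, else `1` or `0`) and upper neighbour `2^(m+1+g₀)` quanta finite. Then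
`DRSqrt φ ψ ↔ d + g₀ ≥ m_φ + 3`. For bias `≤ 2` (`g₀ = 0`) this is `drSqrt_iff_deep`; e.g. e3m2
(`m = 2`, bias `3`, `g₀ = 1`): innocuous iff `d ≥ 4`; e4m3 (bias `7`, `g₀ = 3`): iff `d ≥ 3`;
e5m2 (bias `15`, `g₀ = 7 ≥ m + 2`): every `d ≥ 1`. [this packet] -/
theorem drSqrt_iff_threshold {φ ψ : Format} (hT : sqrtCapFree φ.manBits = true)
    (hE : embedsTest φ ψ = true) (hm : 2 * φ.manBits + 3 ≤ ψ.manBits) (h1 : 1 ≤ φ.manBits)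
    (hq1 : ψ.qexp + 1 ≤ φ.qexp)
    (hR : (2 ^ (φ.manBits + 1) - 1) * 2 ^ (2 * ((φ.bias - 1) / 2) + 2 - φ.bias) ≤ φ.maxScaled)
    (hu : 2 ^ (φ.manBits + 1) * 2 ^ ((φ.bias - 1) / 2) ≤ φ.maxScaled) :
    DRSqrt φ ψ ↔ φ.manBits + 3 ≤ (φ.qexp - ψ.qexp).toNat + (φ.bias - 1) / 2 := by
  refine ⟨fun h => ?_, drSqrt_of_capFree hT hE hm h1 hq1⟩
  by_contra hd
  obtain ⟨zM, hzM⟩ := exists_toRat_eq_maxRat_of_test hE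
  have hmax : φ.maxRat ≤ ψ.maxRat := hzM ▸ (le_abs_self _).trans (abs_toRat_le_maxRat zM)
  exact not_drSqrt_of_shallow (g := (φ.bias - 1) / 2) hq1 hmax h1 (by omega) (by omega) hR hu
    (by omega) h

/-- Parameter test of THEOREM D-sqrt-T's sufficiency half, GIVEN the capture table of `m_φ`
(the caller supplies `sqrtCapFree m_φ = true`; see `drSqrt_of_threshTest`). [this packet] -/
def drSqrtThreshTest (φ ψ : Format) : Bool :=
  embedsTest φ ψ && decide (2 * φ.manBits + 3 ≤ ψ.manBits) && decide (1 ≤ φ.manBits) &&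
    decide (ψ.qexp + 1 ≤ φ.qexp) &&
    decide (φ.manBits + 3 ≤ (φ.qexp - ψ.qexp).toNat + (φ.bias - 1) / 2)

/-- Soundness of the threshold test, given the capture table. [this packet] -/
theorem drSqrt_of_threshTest {φ ψ : Format} (hT : sqrtCapFree φ.manBits = true)
    (h : drSqrtThreshTest φ ψ = true) : DRSqrt φ ψ := by
  simp only [drSqrtThreshTest, Bool.and_eq_true, decide_eq_true_eq] at h
  obtain ⟨⟨⟨⟨hE, hm⟩, h1⟩, hq1⟩, hd⟩ := h
  exact drSqrt_of_capFree hT hE hm h1 hq1 hd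

end Summit.Ventures.CertifiedArithmetic
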